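import Literature.AlgebraicGeometry.HodgeTheory.TwistedReflexiveClassOfSchemeIso
import Literature.AlgebraicGeometry.HodgeTheory.SigmaPerfectAdmissibility
import HarnessLib

/-!
# The INITIAL-SEGMENT repair of the twisted-perfect door's admissibility notions: `bfSingleAdmissible'` and
# `sigmaPerfectAdmissible'` (the typed notion AND «`{q | q+1 ∈ I}` is an initial segment of `ℕ`»), with their bookkeeping

Family `hodge`, layer `Literature/AlgebraicGeometry/HodgeTheory`. VOCABULARY ONLY: three definitions with body and PROVED
one-line lemmas; NO named fact, nothing asserted about any conjecture, no declaration of another file touched. Requested by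
the tenure planner of road b02 (`Summits/HodgeConjecture/HodgeConjecture/Theses/VHCAbelianSchemesRoad.lean`, ask
`LEAD/ASK#door-admissibility-prime`, binder item stmt-HodgeConjecture-19275 `TwistedPerfectDoor`) after the door-slice audit of
that binder.

WHY. The object class `twistedReflexiveClass C Adm n X₀ I κ` of `SemiregularVariationalHodgeTwistedPerfect.lean` quantifies the
`B`-field `B₀` FREELY while the admissibility schema `Adm : PerfectAdmissibility` cannot see `B₀`; both typed notions
(`bfSingleAdmissible` there, `sigmaPerfectAdmissible` in `SigmaPerfectAdmissibility.lean`) test partial `I`-semiregularity of the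
UNTWISTED complex. In print the twisted criterion uses the semiregularity map of the twisted object `ℱ = F ⊗ M^{1/r}` on the
gerbe ([Pridham2024Semiregularity] Rem. 2.26 with Cor. 2.25: «replacing `X` with `X̃_α` … immediately extends their conclusions
to `μ_r`-twisted perfect complexes `ℱ`»), whose Atiyah class is `At(F) + B₀·id`, so that

  `σ^{B₀}_q(x) = Tr(x · At(ℱ)^q)/q! = Σ_{i ≤ q} (B₀^i/i!) ∪ σ_{q−i}(x)`

— a UNIPOTENT LOWER-TRIANGULAR transform of `(σ_q)_q`. Hence joint injectivity of `(σ^{B₀}_q)_{q ∈ I'}` and of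
`(σ_q)_{q ∈ I'}` agree whenever `I' = {q | q+1 ∈ I}` is an INITIAL SEGMENT `{0, …, m}` of `ℕ` (and for `B₀ = 0`, Buchweitz–Flenner's
refereed Thm. 5.1, for every `I`). The primed notions below add exactly this initial-segment conjunct to the typed notions, so
that a door stated for them is print-supported (Pridham 2024 / Perry 2026 Thm. 1.1 / Buchweitz–Flenner 2003 Thm. 5.1) on its
whole domain. What this file provides:

* §1 `Finset.IsShiftedInitialSegment I` — «`q+1 ∈ I ⟹ q'+1 ∈ I` for all `q' ≤ q`», with the instances the roads use
  (`∅`, `Finset.range`, `Finset.Icc 1 m`, `Finset.Iic`, and «`{1, …, n} ⊆ I ⊆ {0, …, n}`»).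
* §2 `bfSingleAdmissible' := bfSingleAdmissible ∧ IsShiftedInitialSegment`, `sigmaPerfectAdmissible' := sigmaPerfectAdmissible ∧
  IsShiftedInitialSegment`; projections, constructors, `bfSingleAdmissible' ⟹ sigmaPerfectAdmissible'`
  (`sigmaPerfectAdmissible_of_bfSingleAdmissible`), and the single-sheaf criterion `sigmaPerfectAdmissible'_single₀_iff`.
* §3 TRANSPORT along isomorphisms of `ℂ`-schemes: `bfSingleAdmissible'.pullback_of_schemeIso` (from
  `bfSingleAdmissible.pullback_of_schemeIso`; the index condition does not see the scheme), the displayed shape, the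
  disjunction `P ∨ bfSingleAdmissible'` for an invariant `P`, and the doors `twistedReflexiveClass C bfSingleAdmissible'`,
  `twistedReflexiveClass C (P ∨ bfSingleAdmissible')` RESPECT ISOMORPHISMS (`twistedReflexiveClass_respectsIso_of_adm`).
* §4 door bookkeeping by the door file's own (anti)monotonicity: the primed classes are SUB-classes
  (`twistedReflexiveClass.mono`), so `TwistedPerfectDoorVHC C bfSingleAdmissible ⟹ TwistedPerfectDoorVHC C bfSingleAdmissible'`,
  the same for `sigmaPerfect`, for disjunctions `P ∨ ·`, and `TwistedPerfectDoorVHC C sigmaPerfectAdmissible' ⟹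
  TwistedPerfectDoorVHC C bfSingleAdmissible'`.

NOT here: the `B₀`-indexed schema (the alternative repair: `Adm n X₀ I E B₀ :=` `I`-semiregularity of `At(E) + B₀·id`, which needs
the door file's `twistedReflexiveClass` to pass its own `B₀`); the transport of `sigmaPerfectAdmissible'` along scheme isomorphisms
(the Literature copy of the complex-level `σ_q` has no base-change lemma in this layer; the venture copy has —
`Summits/Ventures/HSemireg/HomComplexSigmaOfSchemeIso.lean`); any claim that a door holds. Nothing here asserts HC / HC_AV / VHC.

References: [Pridham2024Semiregularity] J. P. Pridham, Forum Math. Sigma 12 (2024) e126, Cor. 2.25, Rem. 2.26 (twisted perfect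
complexes via the gerbe) · [BuchweitzFlenner2003] R.-O. Buchweitz, H. Flenner, Compositio Math. 137 (2003), Def. 4.1 and §5
(`I`-semiregular), Thm. 5.1 · [Perry2026Semiregularity] A. Perry, arXiv:2604.00511, Thm. 1.1 and Def. 2.4 ·
[HuybrechtsStellari2005] D. Huybrechts, P. Stellari, §1 (`ch^B = exp(B)·ch`, `At` of a twisted sheaf).
-/

noncomputable section

open CategoryTheory CategoryTheory.Limits AlgebraicGeometry
open AlgebraicGeometry.Scheme.Modules
open Literature.AlgebraicTopology.SingularHomology
open Literature.AlgebraicGeometry.KTheory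

/-! ### §1 The index condition: `{q | q + 1 ∈ I}` is an initial segment of `ℕ` -/

namespace Finset

/-- **`{q | q + 1 ∈ I}` is an initial segment of `ℕ`** (downward closed): if `σ_q` is tested (`q + 1 ∈ I`) then so is every `σ_{q'}`,
`q' ≤ q`. Under this condition the twisted semiregularity components `σ^{B₀}_q = Σ_{i ≤ q} (B₀^i/i!) ∪ σ_{q−i}` and the untwisted
`σ_q`, `q + 1 ∈ I`, have the same joint kernel. [cite: Pridham2024Semiregularity, Rem. 2.26 with Cor. 2.25]
[cite: BuchweitzFlenner2003, §5 (I-semiregular)] -/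
def IsShiftedInitialSegment (I : Finset ℕ) : Prop :=
  ∀ q, q + 1 ∈ I → ∀ q' ≤ q, q' + 1 ∈ I

variable {I : Finset ℕ}

/-- Unfolding lemma. [cite: BuchweitzFlenner2003, §5 (I-semiregular)] -/
theorem isShiftedInitialSegment_iff : I.IsShiftedInitialSegment ↔ ∀ q, q + 1 ∈ I → ∀ q' ≤ q, q' + 1 ∈ I := Iff.rfl

/-- The empty index set qualifies (nothing is tested). [cite: BuchweitzFlenner2003, §5 (I-semiregular)] -/
theorem isShiftedInitialSegment_empty : (∅ : Finset ℕ).IsShiftedInitialSegment :=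
  fun _ h => absurd h (Finset.notMem_empty _)

/-- `{0, …, m − 1} = Finset.range m` qualifies. [cite: BuchweitzFlenner2003, §5 (I-semiregular)] -/
theorem isShiftedInitialSegment_range (m : ℕ) : (Finset.range m).IsShiftedInitialSegment :=
  fun _ hq _ hq' => Finset.mem_range.2 (lt_of_le_of_lt (Nat.succ_le_succ hq') (Finset.mem_range.1 hq))

/-- `{0, …, m} = Finset.Iic m` qualifies. [cite: BuchweitzFlenner2003, §5 (I-semiregular)] -/
theorem isShiftedInitialSegment_Iic (m : ℕ) : (Finset.Iic m).IsShiftedInitialSegment :=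
  fun _ hq _ hq' => Finset.mem_Iic.2 (le_trans (Nat.succ_le_succ hq') (Finset.mem_Iic.1 hq))

/-- `{a, …, m} = Finset.Icc a m` qualifies as soon as `a ≤ 1` (in particular `{1, …, m}`, the index sets of the roads' cells, and
`{0, …, m}`). [cite: BuchweitzFlenner2003, §5 (I-semiregular)] -/
theorem isShiftedInitialSegment_Icc {a : ℕ} (ha : a ≤ 1) (m : ℕ) : (Finset.Icc a m).IsShiftedInitialSegment :=
  fun _ hq q' hq' => Finset.mem_Icc.2
    ⟨le_trans ha (Nat.le_add_left 1 q'), le_trans (Nat.succ_le_succ hq') (Finset.mem_Icc.1 hq).2⟩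

/-- **An index set squeezed between `{1, …, n}` and `{0, …, n}` qualifies** — the shape `{1, …, n} ⊆ I` of the gluable σ-notion's
cell clause, once `I ⊆ {0, …, n}` (degrees above the dimension carry no classes). [cite: BuchweitzFlenner2003, §5 (I-semiregular)] -/
theorem isShiftedInitialSegment_of_Icc_subset_of_subset_Iic {n : ℕ} (h₁ : Finset.Icc 1 n ⊆ I) (h₂ : I ⊆ Finset.Iic n) :
    I.IsShiftedInitialSegment :=
  fun _ hq q' hq' => h₁ (Finset.mem_Icc.2 ⟨Nat.le_add_left 1 q', le_trans (Nat.succ_le_succ hq') (Finset.mem_Iic.1 (h₂ hq))⟩)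

/-- Downward closure, one step: `q + 1 ∈ I ⟹ q' + 1 ∈ I` for `q' ≤ q`. [cite: BuchweitzFlenner2003, §5 (I-semiregular)] -/
theorem IsShiftedInitialSegment.mem_of_le (h : I.IsShiftedInitialSegment) {q q' : ℕ} (hq : q + 1 ∈ I) (hq' : q' ≤ q) :
    q' + 1 ∈ I :=
  h q hq q' hq'

/-- If some `σ_q` is tested then `σ_0` (the trace `Ext² → H²(𝒪)`) is tested: `1 ∈ I`. [cite: BuchweitzFlenner2003, §5 (I-semiregular)] -/
theorem IsShiftedInitialSegment.one_mem (h : I.IsShiftedInitialSegment) {q : ℕ} (hq : q + 1 ∈ I) : 1 ∈ I :=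
  h q hq 0 (Nat.zero_le q)

end Finset

namespace Literature.AlgebraicGeometry.HodgeTheory

open Literature.AlgebraicGeometry.Motives Literature.AlgebraicGeometry.Modules

/-! ### §2 The primed admissibility notions -/

section Defs

/-- **`bfSingleAdmissible'` — Buchweitz–Flenner's typed notion WITH the initial-segment conjunct**: `E` has zero terms off
degree `0`, its degree-`0` term is isomorphic to an `I`-semiregular vector bundle (`bfSingleAdmissible`), AND `{q | q + 1 ∈ I}` is an
initial segment of `ℕ`. On this domain the `B`-twisted criterion of Pridham's Rem. 2.26 (semiregularity of the twisted object,
`σ^{B₀}_q = Σ_{i ≤ q} (B₀^i/i!) ∪ σ_{q−i}`) and the untwisted `I`-semiregularity tested by `bfSingleAdmissible` coincide.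
[cite: BuchweitzFlenner2003, §5 (I-semiregular) and Thm. 5.1] [cite: Pridham2024Semiregularity, Rem. 2.26 with Cor. 2.25] -/
def bfSingleAdmissible' : PerfectAdmissibility := fun n X₀ I E =>
  bfSingleAdmissible n X₀ I E ∧ I.IsShiftedInitialSegment

/-- **`sigmaPerfectAdmissible'` — the intended notion (Buchweitz–Flenner `I`-semiregularity of a strictly perfect complex,
`sigmaPerfectAdmissible`) WITH the initial-segment conjunct.** [cite: BuchweitzFlenner2003, Def. 4.1 and §5 (I-semiregular)]
[cite: Pridham2024Semiregularity, Rem. 2.26 with Cor. 2.25] -/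
def sigmaPerfectAdmissible' : PerfectAdmissibility := fun n X₀ I E =>
  sigmaPerfectAdmissible n X₀ I E ∧ I.IsShiftedInitialSegment

variable {n : ℕ} {X₀ : SchemeOver ℂ} {I : Finset ℕ} {E : CochainComplex X₀.left.Modules ℤ}

/-- Unfolding lemma. [cite: BuchweitzFlenner2003, §5 (I-semiregular)] -/
theorem bfSingleAdmissible'_iff :
    bfSingleAdmissible' n X₀ I E ↔ bfSingleAdmissible n X₀ I E ∧ I.IsShiftedInitialSegment := Iff.rfl

/-- Unfolding lemma. [cite: BuchweitzFlenner2003, Def. 4.1 and §5 (I-semiregular)] -/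
theorem sigmaPerfectAdmissible'_iff :
    sigmaPerfectAdmissible' n X₀ I E ↔ sigmaPerfectAdmissible n X₀ I E ∧ I.IsShiftedInitialSegment := Iff.rfl

/-- The primed notion refines the typed one. [cite: BuchweitzFlenner2003, §5 (I-semiregular)] -/
theorem bfSingleAdmissible_of_prime (h : bfSingleAdmissible' n X₀ I E) : bfSingleAdmissible n X₀ I E := h.1

/-- The index condition of a primed-admissible complex. [cite: BuchweitzFlenner2003, §5 (I-semiregular)] -/
theorem bfSingleAdmissible'.isShiftedInitialSegment (h : bfSingleAdmissible' n X₀ I E) : I.IsShiftedInitialSegment := h.2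

/-- Constructor. [cite: BuchweitzFlenner2003, §5 (I-semiregular)] -/
theorem bfSingleAdmissible'.mk (h : bfSingleAdmissible n X₀ I E) (hI : I.IsShiftedInitialSegment) :
    bfSingleAdmissible' n X₀ I E := ⟨h, hI⟩

/-- The primed notion refines the intended one. [cite: BuchweitzFlenner2003, Def. 4.1 and §5 (I-semiregular)] -/
theorem sigmaPerfectAdmissible_of_prime (h : sigmaPerfectAdmissible' n X₀ I E) :
    sigmaPerfectAdmissible n X₀ I E := h.1

/-- The index condition of a primed-σ-admissible complex. [cite: BuchweitzFlenner2003, §5 (I-semiregular)] -/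
theorem sigmaPerfectAdmissible'.isShiftedInitialSegment (h : sigmaPerfectAdmissible' n X₀ I E) :
    I.IsShiftedInitialSegment := h.2

/-- Constructor. [cite: BuchweitzFlenner2003, Def. 4.1 and §5 (I-semiregular)] -/
theorem sigmaPerfectAdmissible'.mk (h : sigmaPerfectAdmissible n X₀ I E) (hI : I.IsShiftedInitialSegment) :
    sigmaPerfectAdmissible' n X₀ I E := ⟨h, hI⟩

/-- The schema-level inclusions `bfSingleAdmissible' ≤ bfSingleAdmissible` in the shape the door file's (anti)monotonicity lemmas
consume. [cite: BuchweitzFlenner2003, §5 (I-semiregular)] -/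
theorem bfSingleAdmissible'_le : ∀ n X₀ I E, bfSingleAdmissible' n X₀ I E → bfSingleAdmissible n X₀ I E :=
  fun _ _ _ _ h => h.1

/-- `sigmaPerfectAdmissible' ≤ sigmaPerfectAdmissible`, schema shape. [cite: BuchweitzFlenner2003, Def. 4.1 and §5 (I-semiregular)] -/
theorem sigmaPerfectAdmissible'_le : ∀ n X₀ I E, sigmaPerfectAdmissible' n X₀ I E → sigmaPerfectAdmissible n X₀ I E :=
  fun _ _ _ _ h => h.1

/-- **The typed slice is contained in the intended notion, primed version**: `bfSingleAdmissible' ⟹ sigmaPerfectAdmissible'`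
(`sigmaPerfectAdmissible_of_bfSingleAdmissible` and the common index conjunct). [cite: BuchweitzFlenner2003, §5 (I-semiregular) and Def. 4.1] -/
theorem sigmaPerfectAdmissible'_of_bfSingleAdmissible' (h : bfSingleAdmissible' n X₀ I E) :
    sigmaPerfectAdmissible' n X₀ I E :=
  ⟨sigmaPerfectAdmissible_of_bfSingleAdmissible h.1, h.2⟩

/-- Schema shape of the previous lemma. [cite: BuchweitzFlenner2003, §5 (I-semiregular) and Def. 4.1] -/
theorem bfSingleAdmissible'_le_sigmaPerfectAdmissible' :
    ∀ n X₀ I E, bfSingleAdmissible' n X₀ I E → sigmaPerfectAdmissible' n X₀ I E :=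
  fun _ _ _ _ h => sigmaPerfectAdmissible'_of_bfSingleAdmissible' h

/-- **Single-sheaf criterion, primed**: a vector bundle `E₀` placed in degree `0` is primed-σ-admissible iff `E₀` is
`I`-semiregular as a module and `{q | q + 1 ∈ I}` is an initial segment (`sigmaPerfectAdmissible_single₀_iff`).
[cite: BuchweitzFlenner2003, §5 (I-semiregular) and §4] -/
theorem sigmaPerfectAdmissible'_single₀_iff (E₀ : X₀.left.Modules) (hE₀ : IsFiniteLocallyFree E₀) :
    sigmaPerfectAdmissible' n X₀ I (HomComplex.single₀ X₀.left E₀) ↔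
      IsISemiregular hE₀ {q | q + 1 ∈ I} ∧ I.IsShiftedInitialSegment := by
  rw [sigmaPerfectAdmissible'_iff, sigmaPerfectAdmissible_single₀_iff]

/-- **An `I`-semiregular vector bundle in degree `0` is primed-BF-admissible for an initial-segment index set** (witness `E₀[0]`
with the identity model). [cite: BuchweitzFlenner2003, §5 (I-semiregular)] -/
theorem bfSingleAdmissible'_single (E₀ : X₀.left.Modules) (hE₀ : IsFiniteLocallyFree E₀)
    (hsr : IsISemiregular hE₀ {q | q + 1 ∈ I}) (hI : I.IsShiftedInitialSegment) :
    bfSingleAdmissible' n X₀ I ((HomologicalComplex.single _ (ComplexShape.up ℤ) 0).obj E₀) :=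
  ⟨⟨fun i hi => HomologicalComplex.isZero_single_obj_X (ComplexShape.up ℤ) 0 E₀ i hi, E₀, hE₀,
    ⟨HomologicalComplex.singleObjXSelf (ComplexShape.up ℤ) 0 E₀⟩, hsr⟩, hI⟩

end Defs

/-! ### §3 Transport along isomorphisms of `ℂ`-schemes -/

section Transport

variable {n : ℕ} {Y Y' : SchemeOver ℂ}

/-- **`bfSingleAdmissible'` is invariant under pull-back along an isomorphism `e : Y' ≅ Y` of `ℂ`-schemes**: the BF part by
`bfSingleAdmissible.pullback_of_schemeIso` (the `I`-semiregular model `(e⁻¹)_* F` of `e^* E⁰`), the index condition verbatim.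
[cite: BuchweitzFlenner2003, Def. 4.1 and §5 (I-semiregular)] -/
theorem bfSingleAdmissible'.pullback_of_schemeIso (e : Y' ≅ Y) {I : Finset ℕ} {E : CochainComplex Y.left.Modules ℤ}
    (h : bfSingleAdmissible' n Y I E) :
    bfSingleAdmissible' n Y' I (((Scheme.Modules.pullback e.hom.left).mapHomologicalComplex _).obj E) :=
  ⟨h.1.pullback_of_schemeIso e, h.2⟩

/-- The displayed shape: `bfSingleAdmissible'` is invariant under pull-back along every isomorphism of `ℂ`-schemes (no
hypothesis). [cite: BuchweitzFlenner2003, §5 (I-semiregular)] -/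
theorem bfSingleAdmissible'_pullback_of_schemeIso :
    ∀ (n : ℕ) ⦃Y Y' : SchemeOver ℂ⦄ (e : Y' ≅ Y) (I : Finset ℕ) (E : CochainComplex Y.left.Modules ℤ),
      IsBoundedVBComplex E → bfSingleAdmissible' n Y I E →
        bfSingleAdmissible' n Y' I (((Scheme.Modules.pullback e.hom.left).mapHomologicalComplex _).obj E) :=
  fun _ _ _ e _ _ _ h => h.pullback_of_schemeIso e

variable {P : PerfectAdmissibility}

/-- **A disjunction `P ∨ bfSingleAdmissible'` is invariant under pull-back along isomorphisms as soon as `P` is** — the shape of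
a primed twisted door `AdmTw' := gluableSigmaAdmissible ∨ bfSingleAdmissible'`. [cite: BuchweitzFlenner2003, §5 (I-semiregular)] -/
theorem or_bfSingleAdmissible'_pullback_of_schemeIso
    (hP : ∀ (n : ℕ) ⦃Y Y' : SchemeOver ℂ⦄ (e : Y' ≅ Y) (I : Finset ℕ) (E : CochainComplex Y.left.Modules ℤ),
      IsBoundedVBComplex E → P n Y I E → P n Y' I (((Scheme.Modules.pullback e.hom.left).mapHomologicalComplex _).obj E)) :
    ∀ (n : ℕ) ⦃Y Y' : SchemeOver ℂ⦄ (e : Y' ≅ Y) (I : Finset ℕ) (E : CochainComplex Y.left.Modules ℤ),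
      IsBoundedVBComplex E → (P n Y I E ∨ bfSingleAdmissible' n Y I E) →
        (P n Y' I (((Scheme.Modules.pullback e.hom.left).mapHomologicalComplex _).obj E) ∨
          bfSingleAdmissible' n Y' I (((Scheme.Modules.pullback e.hom.left).mapHomologicalComplex _).obj E)) :=
  fun n _ _ e I E hE h => h.imp (hP n e I E hE) fun hbf => hbf.pullback_of_schemeIso e

variable (C : ChernCharacterBetti)

/-- **The door `twistedReflexiveClass C bfSingleAdmissible'` RESPECTS ISOMORPHISMS of `ℂ`-schemes, unconditionally.**
[cite: BuchweitzFlenner2003, §5 (I-semiregular)] [cite: Perry2026Semiregularity, Thm. 1.1 (hypotheses)] -/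
theorem twistedReflexiveClass_bfSingle'_respectsIso :
    ∀ (n : ℕ) ⦃Y Y' : SchemeOver ℂ⦄ (e : Y' ≅ Y) (I : Finset ℕ) (κ : (q : ℕ) → complexBetti Y (2 * q)),
      twistedReflexiveClass C bfSingleAdmissible' n Y I κ →
        twistedReflexiveClass C bfSingleAdmissible' n Y' I (fun q => complexBetti.map e.hom (2 * q) (κ q)) :=
  twistedReflexiveClass_respectsIso_of_adm C bfSingleAdmissible' bfSingleAdmissible'_pullback_of_schemeIso

/-- **The door `twistedReflexiveClass C (P ∨ bfSingleAdmissible')` RESPECTS ISOMORPHISMS as soon as `P` is invariant under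
pull-back along isomorphisms of `ℂ`-schemes** (on bounded complexes of vector bundles).
[cite: Perry2026Semiregularity, Thm. 1.1 (hypotheses)] [cite: BuchweitzFlenner2003, §5 (I-semiregular)] -/
theorem twistedReflexiveClass_respectsIso_or_bfSingle'
    (hP : ∀ (n : ℕ) ⦃Y Y' : SchemeOver ℂ⦄ (e : Y' ≅ Y) (I : Finset ℕ) (E : CochainComplex Y.left.Modules ℤ),
      IsBoundedVBComplex E → P n Y I E → P n Y' I (((Scheme.Modules.pullback e.hom.left).mapHomologicalComplex _).obj E)) :
    ∀ (n : ℕ) ⦃Y Y' : SchemeOver ℂ⦄ (e : Y' ≅ Y) (I : Finset ℕ) (κ : (q : ℕ) → complexBetti Y (2 * q)),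
      twistedReflexiveClass C (fun n X₀ I E => P n X₀ I E ∨ bfSingleAdmissible' n X₀ I E) n Y I κ →
        twistedReflexiveClass C (fun n X₀ I E => P n X₀ I E ∨ bfSingleAdmissible' n X₀ I E) n Y' I
          (fun q => complexBetti.map e.hom (2 * q) (κ q)) :=
  twistedReflexiveClass_respectsIso_of_adm C _ (or_bfSingleAdmissible'_pullback_of_schemeIso hP)

end Transport

/-! ### §4 Door bookkeeping: the primed object classes are sub-classes; doors transfer to the primed notions -/

section Doors

variable (C : ChernCharacterBetti) {n : ℕ} {X₀ : SchemeOver ℂ} {I : Finset ℕ} {κ : (p : ℕ) → complexBetti X₀ (2 * p)}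
variable {P : PerfectAdmissibility}

/-- A member for the primed BF notion is a member for the typed one. [cite: Perry2026Semiregularity, Thm. 1.1 (hypotheses)] -/
theorem twistedReflexiveClass_bfSingle_of_bfSingle' (h : twistedReflexiveClass C bfSingleAdmissible' n X₀ I κ) :
    twistedReflexiveClass C bfSingleAdmissible n X₀ I κ :=
  h.mono bfSingleAdmissible'_le

/-- A member for the primed σ-notion is a member for the intended one. [cite: Perry2026Semiregularity, Thm. 1.1 (hypotheses)] -/
theorem twistedReflexiveClass_sigmaPerfect_of_sigmaPerfect' (h : twistedReflexiveClass C sigmaPerfectAdmissible' n X₀ I κ) :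
    twistedReflexiveClass C sigmaPerfectAdmissible n X₀ I κ :=
  h.mono sigmaPerfectAdmissible'_le

/-- A member for `bfSingleAdmissible'` is a member for `sigmaPerfectAdmissible'`. [cite: BuchweitzFlenner2003, §5 (I-semiregular)] -/
theorem twistedReflexiveClass_sigmaPerfect'_of_bfSingle' (h : twistedReflexiveClass C bfSingleAdmissible' n X₀ I κ) :
    twistedReflexiveClass C sigmaPerfectAdmissible' n X₀ I κ :=
  h.mono bfSingleAdmissible'_le_sigmaPerfectAdmissible'

/-- The disjunctive door shrinks with its BF disjunct: a member for `P ∨ bfSingleAdmissible'` is one for `P ∨ bfSingleAdmissible`.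
[cite: Perry2026Semiregularity, Thm. 1.1 (hypotheses)] -/
theorem twistedReflexiveClass_or_bfSingle_of_or_bfSingle'
    (h : twistedReflexiveClass C (fun n X₀ I E => P n X₀ I E ∨ bfSingleAdmissible' n X₀ I E) n X₀ I κ) :
    twistedReflexiveClass C (fun n X₀ I E => P n X₀ I E ∨ bfSingleAdmissible n X₀ I E) n X₀ I κ :=
  h.mono fun _ _ _ _ h' => h'.imp_right fun hbf => hbf.1

/-- **The index sets of primed members are initial segments**: any member of a `bfSingleAdmissible'`-door has
`{q | q + 1 ∈ I}` downward closed. [cite: BuchweitzFlenner2003, §5 (I-semiregular)] -/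
theorem twistedReflexiveClass_bfSingle'_isShiftedInitialSegment (h : twistedReflexiveClass C bfSingleAdmissible' n X₀ I κ) :
    I.IsShiftedInitialSegment := by
  obtain ⟨_, _, _, hA, _, _, _⟩ := h
  exact hA.2

/-- **`TwistedPerfectDoorVHC C bfSingleAdmissible ⟹ TwistedPerfectDoorVHC C bfSingleAdmissible'`** (antitonicity: a door for the
typed notion serves the primed sub-class). [cite: BuchweitzFlenner2003, §5 Thm. 5.1 (binder shape)] -/
theorem TwistedPerfectDoorVHC.bfSingle'_of_bfSingle (h : TwistedPerfectDoorVHC C bfSingleAdmissible) :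
    TwistedPerfectDoorVHC C bfSingleAdmissible' :=
  h.anti bfSingleAdmissible'_le

/-- **`TwistedPerfectDoorVHC C sigmaPerfectAdmissible ⟹ TwistedPerfectDoorVHC C sigmaPerfectAdmissible'`.**
[cite: BuchweitzFlenner2003, §5 Thm. 5.1 (binder shape)] -/
theorem TwistedPerfectDoorVHC.sigmaPerfect'_of_sigmaPerfect (h : TwistedPerfectDoorVHC C sigmaPerfectAdmissible) :
    TwistedPerfectDoorVHC C sigmaPerfectAdmissible' :=
  h.anti sigmaPerfectAdmissible'_le

/-- **`TwistedPerfectDoorVHC C sigmaPerfectAdmissible' ⟹ TwistedPerfectDoorVHC C bfSingleAdmissible'`** (a door for primed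
`I`-semiregular PERFECT complexes serves the primed Buchweitz–Flenner slice). [cite: BuchweitzFlenner2003, §5 Thm. 5.1 (binder shape)] -/
theorem TwistedPerfectDoorVHC.bfSingle'_of_sigmaPerfect' (h : TwistedPerfectDoorVHC C sigmaPerfectAdmissible') :
    TwistedPerfectDoorVHC C bfSingleAdmissible' :=
  h.anti bfSingleAdmissible'_le_sigmaPerfectAdmissible'

/-- **Disjunctive doors transfer**: `TwistedPerfectDoorVHC C (P ∨ bfSingleAdmissible) ⟹ TwistedPerfectDoorVHC C (P ∨ bfSingleAdmissible')`
— restating a binder with the primed BF disjunct WEAKENS it. [cite: BuchweitzFlenner2003, §5 Thm. 5.1 (binder shape)] -/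
theorem TwistedPerfectDoorVHC.or_bfSingle'_of_or_bfSingle
    (h : TwistedPerfectDoorVHC C (fun n X₀ I E => P n X₀ I E ∨ bfSingleAdmissible n X₀ I E)) :
    TwistedPerfectDoorVHC C (fun n X₀ I E => P n X₀ I E ∨ bfSingleAdmissible' n X₀ I E) :=
  h.anti fun _ _ _ _ h' => h'.imp_right fun hbf => hbf.1

end Doors

end Literature.AlgebraicGeometry.HodgeTheory

end
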